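import Summits.AnomalousDissipation.AnomalousDissipation.Theses.EnsembleRigidity
import Summits.AnomalousDissipation.AnomalousDissipation.Theorems.TaylorCertificatesEnsembleCeilingTransfer
import Literature.Analysis.FluidPDE.TimeAverageEnstrophy
import Literature.Analysis.FluidPDE.ZerothLawProofs
import HarnessLib

/-!
# Sketch — crux-ideate stmt-AnomalousDissipation-15511 (EnsembleRigidity.EnsembleFloorTransfer), ideator 2

Card `own-statistics-monotone-lim`: the path's OWN time-average statistics carry the floor; the
enstrophy of a time-average measure is bounded by `Λ` of the path's Cesàro enstrophy means
(monotonicity of the generalized limit against an unbounded but mean-bounded majorant, through the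
capped Galerkin truncations; FMRT 2001 Ch. IV (1.35), (3.3)–(3.4)), hence by their `limsup`.

Contents: the brick signatures (sorried — NOT proved here, planner seat), the package `PathStatisticsPackage`,
the thinned transfer `EnsembleFloorTransferOwn` (C⁺, formally stronger than the crux) and the two
pure-logic compositions `ensembleFloorTransferOwn_of_package`, `ensembleFloorTransfer_of_own`
(PROVED), the last concluding the crux BY NAME.
-/

noncomputable section

open MeasureTheory Set Filter Topology
open scoped ENNReal NNReal

namespace Summit.AnomalousDissipation.AnomalousDissipation.Cruxes.EnsembleFloorTransfer.OwnStatisticsMonotoneLim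

open Literature.Analysis.FluidPDE Literature.Analysis.FunctionSpaces
open Summit.AnomalousDissipation.AnomalousDissipation.Theorems

/-! ### Brick 1 (δ-free majorant lemma; variant of `IsTimeAverageMeasure.integral_le_of_ae_timeMean_le`
with the constant `B` replaced by `Λ (timeMean k)`; proof = `hμ.integral_eq` + `GeneralizedLimit.apply_mono`). -/
theorem integral_le_longTimeAvg_of_ae_le {Λ : GeneralizedLimit} {U : ℝ → Torus.energySpace (Fin 3)}
    {μ : Measure (Torus.energySpace (Fin 3))} (hμ : Torus.IsTimeAverageMeasure Λ.longTimeAvg U μ)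
    {Ψ : Torus.energySpace (Fin 3) → ℝ} (hΨ : Continuous Ψ) (h0 : ∀ v, 0 ≤ Ψ v) {C : ℝ}
    (hC : ∀ v, Ψ v ≤ C) {k : ℝ → ℝ} (hk : ∀ᵐ t ∂volume, 0 < t → Ψ (U t) ≤ k t)
    (hki : ∀ T, 0 < T → IntegrableOn k (Ioc 0 T)) (hkb : IsBoundedUnder (· ≤ ·) atTop (timeMean k)) :
    ∫ v, Ψ v ∂μ ≤ Λ.longTimeAvg k := by
  sorry

/-! ### Brick 2 (FMRT (3.3)–(3.4) with the path's own `Lim` of the enstrophy means as ceiling: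
monotone convergence in the cap `M`, Fatou in the truncation order `m`, exactly as the tree's
`IsTimeAverageMeasure.lintegral_eGradNormSq_le`, with Brick 1 in place of `integral_min_galerkinEnstrophy_le`). -/
theorem ensembleEnstrophy_le_ofReal_longTimeAvg {ν : ℝ} (hν : 0 < ν)
    {F u₀ : UnitAddTorus (Fin 3) → EuclideanSpace ℝ (Fin 3)} (hF : MemLp F 2 volume)
    {u : ℝ → UnitAddTorus (Fin 3) → EuclideanSpace ℝ (Fin 3)}
    (hu : Torus.IsGlobalLerayHopf ν (fun _ => F) u₀ u)
    {U : ℝ → Torus.energySpace (Fin 3)}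
    (hU : ∀ t, 0 ≤ t →
      (((U t : Lp (EuclideanSpace ℝ (Fin 3)) 2 (volume : Measure (UnitAddTorus (Fin 3)))) :
        UnitAddTorus (Fin 3) → EuclideanSpace ℝ (Fin 3))) =ᵐ[volume] u t)
    {Λ : GeneralizedLimit} {μ : Measure (Torus.energySpace (Fin 3))}
    (hμ : Torus.IsTimeAverageMeasure Λ.longTimeAvg U μ) :
    Torus.ensembleEnstrophy μ ≤
      ENNReal.ofReal (Λ.longTimeAvg fun t => (Torus.eGradNormSq (u t)).toReal) ∧
    Λ.longTimeAvg (fun t => (Torus.eGradNormSq (u t)).toReal) ≤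
      longTimeAvgSup fun t => (Torus.eGradNormSq (u t)).toReal := by
  sorry

/-! ### The package: every lifted Leray–Hopf path has a time-average statistics below it -/

/-- `PathStatisticsPackage`: for `ν > 0`, `f ∈ L²`, every global Leray–Hopf `u` with an `H`-lift `U`
admits a generalized limit `Λ` and a time-average measure `μ` of `U` for `Λ` which is a stationary
statistical solution of NS_ν(f) with integrable energy, `ensembleEnergy μ ≤ meanEnergy u` and
`ensembleDissipation ν μ ≤ meanDissipation ν u`. -/
def PathStatisticsPackage : Prop :=
  ∀ (ν : ℝ) (f u₀ : UnitAddTorus (Fin 3) → EuclideanSpace ℝ (Fin 3))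
    (u : ℝ → UnitAddTorus (Fin 3) → EuclideanSpace ℝ (Fin 3)) (U : ℝ → Torus.energySpace (Fin 3)),
    0 < ν → MemLp f 2 volume → Torus.IsGlobalLerayHopf ν (fun _ => f) u₀ u →
    (∀ t, 0 ≤ t →
      (((U t : Lp (EuclideanSpace ℝ (Fin 3)) 2 (volume : Measure (UnitAddTorus (Fin 3)))) :
        UnitAddTorus (Fin 3) → EuclideanSpace ℝ (Fin 3))) =ᵐ[volume] u t) →
    ∃ (Λ : GeneralizedLimit) (μ : Measure (Torus.energySpace (Fin 3))),
      Torus.IsTimeAverageMeasure Λ.longTimeAvg U μ ∧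
      Torus.IsStationaryStatisticalSolution ν f μ ∧
      Integrable (fun v : Torus.energySpace (Fin 3) => ‖v‖ ^ 2) μ ∧
      Torus.ensembleEnergy μ ≤ meanEnergy u ∧
      Torus.ensembleDissipation ν μ ≤ meanDissipation ν u

/-- The package from the bricks (sketch; the energy conjuncts are verbatim the proved twin
`meanEnergy_le_of_ensembleCeiling`, the dissipation conjunct is Brick 2 and `longTimeAvgSup_const_mul`). -/
theorem pathStatisticsPackage_holds : PathStatisticsPackage := by
  sorry

/-! ### C⁺: the floor on the path's OWN time-average statistics suffices (formally stronger than the crux) -/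

/-- `EnsembleFloorTransferOwn` (C⁺): as `EnsembleFloorTransfer`, but the floor `ε₀ ≤ ensembleDissipation ν μ`
is only assumed for stationary statistical solutions `μ` that are TIME-AVERAGE MEASURES OF THE GIVEN LIFT `U`
(for some generalized limit), with integrable energy and `ensembleEnergy μ ≤ E`; and `f ∈ L²` replaces smoothness. -/
def EnsembleFloorTransferOwn : Prop :=
  ∀ (ν E ε₀ : ℝ) (f u₀ : UnitAddTorus (Fin 3) → EuclideanSpace ℝ (Fin 3))
    (u : ℝ → UnitAddTorus (Fin 3) → EuclideanSpace ℝ (Fin 3)) (U : ℝ → Torus.energySpace (Fin 3)),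
    0 < ν → MemLp f 2 volume → Torus.IsGlobalLerayHopf ν (fun _ => f) u₀ u →
    (∀ t, 0 ≤ t →
      (((U t : Lp (EuclideanSpace ℝ (Fin 3)) 2 (volume : Measure (UnitAddTorus (Fin 3)))) :
        UnitAddTorus (Fin 3) → EuclideanSpace ℝ (Fin 3))) =ᵐ[volume] u t) →
    meanEnergy u ≤ E →
    (∀ (Λ : GeneralizedLimit) (μ : Measure (Torus.energySpace (Fin 3))),
      Torus.IsTimeAverageMeasure Λ.longTimeAvg U μ → Torus.IsStationaryStatisticalSolution ν f μ →
      Integrable (fun v : Torus.energySpace (Fin 3) => ‖v‖ ^ 2) μ → Torus.ensembleEnergy μ ≤ E →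
      ε₀ ≤ Torus.ensembleDissipation ν μ) →
    ε₀ ≤ meanDissipation ν u

/-- C⁺ from the package (pure logic). -/
theorem ensembleFloorTransferOwn_of_package (hP : PathStatisticsPackage) : EnsembleFloorTransferOwn := by
  intro ν E ε₀ f u₀ u U hν hf hu hU hE hfloor
  obtain ⟨Λ, μ, hta, hsss, hint, hEμ, hDμ⟩ := hP ν f u₀ u U hν hf hu hU
  exact (hfloor Λ μ hta hsss hint (hEμ.trans hE)).trans hDμ

/-- The crux from C⁺ (pure logic: the crux assumes the floor for ALL stationary statistical solutions with
integrable energy below `E`; `f` smooth gives `f ∈ L²`). Concludes the route decl BY NAME. -/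
theorem ensembleFloorTransfer_of_own (h : EnsembleFloorTransferOwn) :
    Summit.AnomalousDissipation.AnomalousDissipation.Theses.EnsembleRigidity.EnsembleFloorTransfer := by
  intro ν E ε₀ f u₀ u U hν hfs _hfd _hfz hfloor hu hU hE
  exact h ν E ε₀ f u₀ u U hν (hfs.memLp 2) hu hU hE
    (fun _Λ μ _hta hsss hint hEμ => hfloor μ hsss hint hEμ)

/-- The crux from the package (the line's composition). -/
theorem ensembleFloorTransfer_of_package (hP : PathStatisticsPackage) :
    Summit.AnomalousDissipation.AnomalousDissipation.Theses.EnsembleRigidity.EnsembleFloorTransfer :=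
  ensembleFloorTransfer_of_own (ensembleFloorTransferOwn_of_package hP)

end Summit.AnomalousDissipation.AnomalousDissipation.Cruxes.EnsembleFloorTransfer.OwnStatisticsMonotoneLim

end
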